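import Summits.BirchSwinnertonDyer.BirchSwinnertonDyer.Theorems.AlignedTransportAtTwoMainConjectureOfRankZeroBSDAtTwoSelmerLayerLambdaBudget
import Literature.NumberTheory.EllipticCurves.SelmerCorankControlRatOrdinaryLayerOddProofs
import HarnessLib

/-!
# Route `AlignedTransportAtTwo`, crux C2 `MainConjectureOfRankZeroBSDAtTwo` (stmt-BirchSwinnertonDyer-22298):
# MAZUR CONTROL IN CORANK FORM AT EVERY LAYER OF THE CYCLOTOMIC `ℤ_p`-TOWER OF `ℚ`, FOR EVERY GOOD ORDINARY `p` —
# unconditional, with the first-layer matching, the Ш-inclusive growth dichotomy and the `λ`-budget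

Cell `bsd-f1-sign2`, WIDTH-5 attach seat `bsd-line-att-p5` gen 42 (lineage att-p5). **BSD is NOT proved; nothing closed; C2 NOT
claimed; verdict «blocked-on Rank1Residual.GreenbergMuConjectureIrreducible» untouched.** All theorems `--supports 22298 --as helper`.

The companion file `…SelmerLayerUnconditional` recorded the `p = 2` case. With Greenberg's Lemma 3.4 now a theorem at every layer
for EVERY good ordinary prime (`Literature/…/SelmerCorankControlRatOrdinaryLayerOddProofs`:
`WeierstrassCurve.finite_localTowerKerPrimary_of_ordinary`; odd `p` via the uniformiser `π_n = N(1 - ζ_{p^{n+1}})` of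
`CyclotomicZpExtensionLayerUniformizerProofs`), g40's layer theorems hold for every good ordinary `p`:

* ★★ `finite_localTowerKerPrimary_of_isOrdinaryAt`, `finite_kerG_of_isOrdinaryAt` — Lemma 3.4 / `ker g_n` finite, every `p`, `n`.
* ★★★★ `selmerCorank_layer_eq_lambdaInvariant_layerQuotient` — **`corank_{ℤ_p} Sel_{p^∞}(E_{ℚ_n}/ℚ_n) = rank_{ℤ_p} X/ω_n X`**
  for every `n` and every good ordinary `p` (Mazur's control theorem in corank form, elementary proof in the tree).
* ★★★★ `selmerCorank_layer_one_eq_add` — `corank Sel_{p^∞}(E_{ℚ_1}) = corank Sel_{p^∞}(E/ℚ) + rank X/ξ_pX`.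
* ★★★★ `selmerCorank_layer_succ_le_or_cyclotomicLayer_dvd`, `sum_totient_selmerGrowthLayers_le_lambdaInvariant`,
  `selmerCorank_layer_succ_le_of_lam_lt` — growth dichotomy and `λ`-budget `∑_{growth layers} pⁿ(p-1) ≤ λ(X)`, every `p`.

Honest framing: COROLLARY-OF-PRINT (Greenberg LNM 1716 Thm 1.2 / 1.9, §3 Lemmas 3.1–3.5, §5 p. 132; Mazur 1972); nothing beyond
print; BSD proved for no curve; PARTITION: none moved.

References: R. Greenberg, LNM 1716 (1999) [GreenbergLNM1716]; B. Mazur, Invent. Math. 18 (1972), §6.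
-/

set_option linter.dupNamespace false
set_option autoImplicit false

noncomputable section

open scoped Classical AddSubgroup TensorProduct Polynomial

universe u

namespace Summit.BirchSwinnertonDyer.BirchSwinnertonDyer.Theorems.AlignedTransportAtTwoSelmerLayerAllPrimes

open Polynomial WeierstrassCurve Literature.NumberTheory.EllipticCurves Literature.NumberTheory.EllipticCurves.IwasawaAlgebra
  Literature.NumberTheory.EllipticCurves.IwasawaDual IsDedekindDomain
  Summit.BirchSwinnertonDyer.Rank1Residual.X1.MuLambda
  Summit.BirchSwinnertonDyer.Rank1Residual.X1.CyclotomicZeros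
  Summit.BirchSwinnertonDyer.BirchSwinnertonDyer.Theorems.AlignedTransportAtTwoSelmerLayerControl
  Summit.BirchSwinnertonDyer.BirchSwinnertonDyer.Theorems.AlignedTransportAtTwoSelmerLayerControlLocal
  Summit.BirchSwinnertonDyer.BirchSwinnertonDyer.Theorems.AlignedTransportAtTwoSelmerLayerGrowthDichotomy
  Summit.BirchSwinnertonDyer.BirchSwinnertonDyer.Theorems.AlignedTransportAtTwoSelmerLayerOneMatching
  Summit.BirchSwinnertonDyer.BirchSwinnertonDyer.Theorems.AlignedTransportAtTwoSelmerLayerLambdaBudget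

variable (W : WeierstrassCurve ℚ) [W.IsElliptic] [W.IsGloballyMinimal] {p : ℕ} [hp : Fact p.Prime] {κ : ZpExtension ℚ p}
  {γ : Field.absoluteGaloisGroup ℚ}

/-- ★★ **Greenberg's Lemma 3.4 at EVERY layer for EVERY good ordinary `p`**: for `W/ℚ` globally minimal, good ordinary at `p`,
the cyclotomic `ℤ_p`-extension `κ`, any `n` and any `v ∣ p`, `𝒦_{v,n}[p^∞] = W.localTowerKerPrimary κ ℚ_v n` is finite
(`WeierstrassCurve.finite_localTowerKerPrimary_of_ordinary`). [cite: GreenbergLNM1716, §3 Lemma 3.4 (p. 89)] -/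
theorem finite_localTowerKerPrimary_of_isOrdinaryAt (hord : IsOrdinaryAt W p) (hκ : κ.IsCyclotomic) (n : ℕ)
    (v : HeightOneSpectrum (NumberField.RingOfIntegers ℚ)) (hv : (p : NumberField.RingOfIntegers ℚ) ∈ v.asIdeal) :
    Finite (W.localTowerKerPrimary κ (v.adicCompletion ℚ) n) :=
  W.finite_localTowerKerPrimary_of_ordinary hv (W.not_dvd_minimalDiscriminantInt_of_hasGoodReductionAtPrime' p hord.1)
    hord.2 κ hκ n

/-- ★★ **Greenberg's `ker g_n` is finite at every layer, every good ordinary `p`** (`…SelmerLayerControlLocal` §2 with Lemma 3.4).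
[cite: GreenbergLNM1716, §3 Lemmas 3.3–3.5 (pp. 86–90)] -/
theorem finite_kerG_of_isOrdinaryAt (hord : IsOrdinaryAt W p) (hκ : κ.IsCyclotomic) (n : ℕ) : Finite (W.KerG κ n) :=
  finite_kerG_of_finite_localTowerKerPrimary_dvd W κ n
    (fun v hv ↦ finite_localTowerKerPrimary_of_isOrdinaryAt W hord hκ n v hv)

/-- ★★★★ **MAZUR CONTROL IN CORANK FORM AT EVERY LAYER, every good ordinary `p`, unconditional:
`corank_{ℤ_p} Sel_{p^∞}(E_{ℚ_n}/ℚ_n) = rank_{ℤ_p} X/ω_n X`** (`W/ℚ` globally minimal, good ordinary at `p`, `κ` cyclotomic with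
topological generator `γ`, ANY Selmer dual datum `D`; `ω_n = (1+T)^{pⁿ} - 1`). g40
`…SelmerLayerControlLocal.selmerCorank_layer_eq_lambdaInvariant_layerQuotient_of_finite_localTowerKerPrimary_dvd` with its local input
now a theorem. [cite: GreenbergLNM1716, Thm 1.2 and §3 Lemma 3.4 (p. 89)] -/
theorem selmerCorank_layer_eq_lambdaInvariant_layerQuotient (hord : IsOrdinaryAt W p) (hκ : κ.IsCyclotomic)
    (hγ : κ.IsTopGenerator γ) (D : W.SelmerDualData κ γ) (n : ℕ) :
    (W.baseChange (κ.layer n)).selmerCorank p =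
      lambdaInvariant p (D.X ⧸ (Ideal.span {((1 + PowerSeries.X : PowerSeries ℤ_[p]) ^ (p ^ n) - 1 : IwasawaAlgebra p)} •
        ⊤ : Submodule (IwasawaAlgebra p) D.X)) := by
  haveI : Module.Finite (IwasawaAlgebra p) D.X := SelmerDualData.module_finite_of_isCyclotomic W κ hκ D hγ
  exact selmerCorank_layer_eq_lambdaInvariant_layerQuotient_of_finite_localTowerKerPrimary_dvd W κ hγ D n
    (fun v hv ↦ finite_localTowerKerPrimary_of_isOrdinaryAt W hord hκ n v hv)

/-- ★★★★ **FIRST-LAYER MATCHING, every good ordinary `p`, unconditional: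
`corank Sel_{p^∞}(E_{ℚ_1}/ℚ_1) = corank Sel_{p^∞}(E/ℚ) + rank_{ℤ_p} X/ξ_pX`** (`ξ_p = Φ_p(1+T)`).
[cite: GreenbergLNM1716, Thm 1.2 and §3 Lemma 3.4 (p. 89)] -/
theorem selmerCorank_layer_one_eq_add (hord : IsOrdinaryAt W p) (hκ : κ.IsCyclotomic) (hγ : κ.IsTopGenerator γ)
    (D : W.SelmerDualData κ γ) :
    (W.baseChange (κ.layer 1)).selmerCorank p =
      W.selmerCorank p + lambdaInvariant p (D.X ⧸ (Ideal.span {xi p} • ⊤ : Submodule (IwasawaAlgebra p) D.X)) :=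
  selmerCorank_layer_one_eq_add_of_finite_localTowerKerPrimary_one W hord.1 hord.2 hκ hγ D
    (fun v hv ↦ finite_localTowerKerPrimary_of_isOrdinaryAt W hord hκ 1 v hv)

/-- ★★★★ **THE Ш-INCLUSIVE GROWTH DICHOTOMY AT EVERY LAYER, every good ordinary `p`, unconditional**: either
`corank Sel_{p^∞}(E_{ℚ_{n+1}}) ≤ corank Sel_{p^∞}(E_{ℚ_n})` or `Ψ_{n+1} = Φ_{p^{n+1}}(1+T) ∣ f` (`X` torsion, `char_Λ X = (f)`).
[cite: GreenbergLNM1716, Thm 1.2, §5 p. 132] -/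
theorem selmerCorank_layer_succ_le_or_cyclotomicLayer_dvd (hord : IsOrdinaryAt W p) (hκ : κ.IsCyclotomic)
    (hγ : κ.IsTopGenerator γ) (D : W.SelmerDualData κ γ) (hD : D.IsTorsion) (n : ℕ) {f : IwasawaAlgebra p}
    (hf : D.charIdeal = Ideal.span {f}) :
    (W.baseChange (κ.layer (n + 1))).selmerCorank p ≤ (W.baseChange (κ.layer n)).selmerCorank p ∨
      (((cyclotomic (p ^ (n + 1)) ℤ_[p]).comp (Polynomial.X + 1) : ℤ_[p][X]) : PowerSeries ℤ_[p]) ∣ f := by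
  haveI : Module.Finite (IwasawaAlgebra p) D.X := SelmerDualData.module_finite_of_isCyclotomic W κ hκ D hγ
  haveI := finite_kerG_of_isOrdinaryAt W hord hκ n
  exact selmerCorank_layer_succ_le_or_cyclotomicLayer_dvd_of_finite_kerG W κ hγ D hD n hf

/-- ★★★★ **THE `λ`-BUDGET, every good ordinary `p`, unconditional: `∑_{n ∈ S} pⁿ(p-1) ≤ λ(X)`** for every finite set `S` of
layers where the `p^∞`-Selmer corank grows from `ℚ_n` to `ℚ_{n+1}` (`X` torsion with `char_Λ X = (f_E)`).
[cite: GreenbergLNM1716, Thm. 1.9 (p. 63) and §5 p. 132] -/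
theorem sum_totient_selmerGrowthLayers_le_lambdaInvariant (hord : IsOrdinaryAt W p) (hκ : κ.IsCyclotomic)
    (hγ : κ.IsTopGenerator γ) (D : W.SelmerDualData κ γ) (hD : D.IsTorsion) {fE : IwasawaAlgebra p}
    (hfE : D.charIdeal = Ideal.span {fE}) (S : Finset ℕ)
    (hS : ∀ n ∈ S, (W.baseChange (κ.layer n)).selmerCorank p < (W.baseChange (κ.layer (n + 1))).selmerCorank p) :
    ∑ n ∈ S, p ^ n * (p - 1) ≤ lambdaInvariant p D.X := by
  haveI : Module.Finite (IwasawaAlgebra p) D.X := SelmerDualData.module_finite_of_isCyclotomic W κ hκ D hγ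
  exact sum_totient_selmerGrowthLayers_le_lambdaInvariant_of_finite_kerG W κ hγ D hD hfE S
    (fun n _ ↦ finite_kerG_of_isOrdinaryAt W hord hκ n) hS

/-- ★★★★ **NO SELMER GROWTH BEYOND THE `λ`-BUDGET, every good ordinary `p`, unconditional**: `pⁿ(p-1) > λ(f_E)` forces
`corank Sel_{p^∞}(E_{ℚ_{n+1}}) ≤ corank Sel_{p^∞}(E_{ℚ_n})`. [cite: GreenbergLNM1716, Thm. 1.9 (p. 63) and §5 p. 132] -/
theorem selmerCorank_layer_succ_le_of_lam_lt (hord : IsOrdinaryAt W p) (hκ : κ.IsCyclotomic)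
    (hγ : κ.IsTopGenerator γ) (D : W.SelmerDualData κ γ) (hD : D.IsTorsion) {fE : IwasawaAlgebra p}
    (hfE : D.charIdeal = Ideal.span {fE}) (n : ℕ) (hlam : lam fE < p ^ n * (p - 1)) :
    (W.baseChange (κ.layer (n + 1))).selmerCorank p ≤ (W.baseChange (κ.layer n)).selmerCorank p := by
  haveI : Module.Finite (IwasawaAlgebra p) D.X := SelmerDualData.module_finite_of_isCyclotomic W κ hκ D hγ
  haveI := finite_kerG_of_isOrdinaryAt W hord hκ n
  exact selmerCorank_layer_succ_le_of_lam_lt_of_finite_kerG W κ hγ D hD hfE n hlam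

end Summit.BirchSwinnertonDyer.BirchSwinnertonDyer.Theorems.AlignedTransportAtTwoSelmerLayerAllPrimes

end
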